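import Summits.QuantumFields.YangMills.Theorems.FluctuationComparisonRegPrIntLOrganTangentFibreMeanVersionKnitDescendTo
import Summits.QuantumFields.YangMills.Theorems.FluctuationComparisonRegPrIntLOrganTangentTowerCutIterate
import Summits.QuantumFields.YangMills.Theorems.FluctuationComparisonRegPrIntLOrganTangentMultiWindowWeight
import HarnessLib

/-!
# `FluctuationComparisonRegPrIntLOrganTangentFibreMeanVersionMW` — (L20) «VERᵐ FROM THE FRAME'S CLAUSES ALONE»: the m-step fibre-mean VERSION along `descendTo F ℰp j K`,
# localised by the frame's multi-level-window weight, with NO (A)-letter, NO weight letter and NO consistency letter — ✓(L17) ∘ ✓(L18) ∘ ✓(L19)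

Cell `ym3-torus` (rung R3 = continuum `SU(2)` Yang–Mills on T³ — NOT d = 4, NOT infinite volume, NOT a mass gap, NOT Clay), width seat `ym-ust-20520-w5` (gen 22),
pen (L20) (CLAIM 2026-08-31 01:07Z; LEAD-20520 w3 g24 WORD №10 «MW lane support — keep landing»).  `--kind proof --supports stmt-QuantumFields-20520 --as helper`,
count-neutral, definition-free, default heartbeats; THEOREMS ONLY; nothing printed is asserted.

WHAT.  For a tower of densities `ρ n : G_n → ℝ` tied by O1's clause ⑦ on `[j, K)` —
`(dU_n)·(ofReal ∘ ρ n) = (descend F ℰp n)_* (((dU_{n+1})·(ofReal ∘ ρ (n+1))) · (ofReal ∘ sfCut θ_{n+1}))` (the v17.2 ∕ v18 one-step shape, `runpair_organ.lean` :219) —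
with `ρ j` measurable and positive on `window_j`, and for top-level densities `ρ K`, `ρ′` positive and continuous on `{PlaqSmall θ_K}` (block ⑧ at height `K`), and for EVERY
disintegration `σ` of `dU_K` along `descendTo F ℰp j K`: a `window_j`-continuous `m` with
`m V = (∫ χ_{j,K}·(log ρ_K − log ρ′)·ρ′ dσ_V) ∕ (∫ χ_{j,K}·ρ′ dσ_V)` for `dU_j`-a.e. window `V`, where `χ_{j,K} U = ∏_{i<K−j} sfCut θ_{j+1+i} (descendTo F ℰp (j+1+i) K U)` is the
frame's multi-level-window weight (R-CUT-χ token spelled out, `Finset.range`∕`dite` spelling of ✓(L18)∕(L19)).  From ONE height `jA` for every `K ≥ j+1 ≥ jA+1`.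
PROOF = three landed bricks: the weight letters ✓(L19) `exists_height_multiWindowWeight`; the consistency `mY := ((dU_K)·ρ_K)·(∏ ofReal ∘ sfCut ∘ descendTo)`,
`mY.map (descendTo j K) = (dU_j)·ρ_j` by ✓(L18) `towerCut_iterate` at `w n := ofReal ∘ sfCut θ_n`, `mY ≪ dU_K` by `withDensity_absolutelyContinuous`; the version by
✓(L17) `exists_height_fibreMeanVersion_descendTo` (itself ✓KNIT-MW ∘ ✓(L16) (A)-package ∘ ✓(L15-MW) chart).
NOT HERE: the v18 row text VERᵐ itself (the ideator's), its E2E re-key (one `intro`∕`exact` over this file once the text is frozen); nothing of Bałaban's estimates.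
[cite: Balaban1985Averaging, (10)-(13) p.19; Balaban1987RG1, (0.11) p.253 and (0.13) p.254; Balaban1985UV3, (7) p.257]

HONEST: a composition of landed kernel facts; nothing of Bałaban's RG estimates is asserted or proved; O1 ∕ O1ᵘ-H ∕ m-step rows ∕ LIN∘ ∕ JVAR∘ ∕ MODE∘ ∕ crux 20520
`FluctuationComparisonRegPrIntL` ∕ `YM3TorusSU2` NOT proved; registry `Lines/semiclassical_s2beta.lean` v11.4 (★★OWNER RULING №36) untouched; rung R3 = SU(2) YM₃ on T³ — NOT d = 4,
NOT infinite volume, NOT a mass gap, NOT Clay; the Yang–Mills mass gap is NOT proved by any of this.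
-/

set_option autoImplicit false

noncomputable section

namespace Summit.QuantumFields.YangMills.Theorems.FluctuationComparisonRegPrIntLOrganTangentFibreMeanVersionMW

open MeasureTheory ProbabilityTheory Filter Topology Set Function
open scoped ENNReal NNReal
open Literature.MathematicalPhysics.QuantumFieldTheory.Balaban1983to89
open T3ContinuumYM3Torus T3NestedUnitLaws T3UnitLawDensityEML T3UnitScaleTilt T3LevelShift T3TiltDescent
open Summit.QuantumFields.YangMills.Theorems.OrganTangentFibreMeanToolsAnyCut (measurable_sfCutRamp)
open Summit.QuantumFields.YangMills.Theorems.FluctuationComparisonRegPrIntLOrganTangentFibreMeanVersionKnitDescendTo (exists_height_fibreMeanVersion_descendTo)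
open Summit.QuantumFields.YangMills.Theorems.FluctuationComparisonRegPrIntLOrganTangentTowerCutIterate (towerCut_iterate measurable_iterWeight)
open Summit.QuantumFields.YangMills.Theorems.FluctuationComparisonRegPrIntLOrganTangentMultiWindowWeight (exists_height_multiWindowWeight)

/-- ★★★ **THE m-STEP FIBRE-MEAN VERSION FROM THE FRAME'S CLAUSES ALONE** (see the module docstring): clause ⑦ on `[j, K)` for a density tower `ρ`, `ρ j` measurable and positive
on `window_j`, top-level `ρ K`, `ρ′` positive and continuous on `{PlaqSmall θ_K}`, ANY disintegration `σ` of `dU_K` along `descendTo F ℰp j K` ⟹ the `window_j`-continuous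
version `m` of the `χ_{j,K}`-localised fibre mean of `log ρ_K − log ρ′`; from one height, for every family and depth.
[cite: Balaban1985Averaging, (10)-(13) p.19; Balaban1987RG1, (0.11) p.253 and (0.13) p.254; Balaban1985UV3, (7) p.257] -/
theorem exists_height_fibreMeanVersionMW_of_towerCut
    (F : T3Family) (γ b₀ p₀ : ℝ) (hγ : 0 < γ) (hγ1 : γ ≤ 1) (hb₀ : 0 < b₀) (hp₀ : 0 < p₀) :
    ∃ jA : ℕ, ∀ (j : ℕ), jA ≤ j → ∀ (K : ℕ) (hjK : j + 1 ≤ K),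
      ∀ (ρ : (n : ℕ) → GaugeField (F.P n) 0 ↥(Matrix.specialUnitaryGroup (Fin 2) ℂ) → ℝ)
        (ρ' : GaugeField (F.P K) 0 ↥(Matrix.specialUnitaryGroup (Fin 2) ℂ) → ℝ),
        (∀ n, Measurable (ρ n)) →
        -- clause ⑦ (one-step SF-projection of the unprimed tower) on `[j, K)`
        (∀ n, j ≤ n → n < K →
          (fieldMeasure (F.P n) 0 ↥(Matrix.specialUnitaryGroup (Fin 2) ℂ)).withDensity (fun V => ENNReal.ofReal (ρ n V)) =
            Measure.map (descend F ℰp n)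
              (((fieldMeasure (F.P (n + 1)) 0 ↥(Matrix.specialUnitaryGroup (Fin 2) ℂ)).withDensity (fun U => ENNReal.ofReal (ρ (n + 1) U))).withDensity
                (fun U => ENNReal.ofReal (∏ p : Plaq (F.P (n + 1)) 0,
                  max 0 (min 1 ((24 / 25 * θBal F.L γ b₀ p₀ (n + 1) - dist1 (GaugeField.plaqHol U p)) / ((24 / 25 - 1 / 2) * θBal F.L γ b₀ p₀ (n + 1)))))))) →
        -- the bottom density is positive on the coarse window; the top densities are positive and continuous on the top window
        (∀ V, PlaqSmall (θBal F.L γ b₀ p₀ j) V → 0 < ρ j V) →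
        (∀ U, PlaqSmall (θBal F.L γ b₀ p₀ K) U → 0 < ρ K U ∧ 0 < ρ' U) →
        ContinuousOn (ρ K) {U | PlaqSmall (θBal F.L γ b₀ p₀ K) U} → ContinuousOn ρ' {U | PlaqSmall (θBal F.L γ b₀ p₀ K) U} →
      ∀ (σ : Kernel (GaugeField (F.P j) 0 ↥(Matrix.specialUnitaryGroup (Fin 2) ℂ)) (GaugeField (F.P K) 0 ↥(Matrix.specialUnitaryGroup (Fin 2) ℂ))),
        IsMarkovKernel σ →
        (Measure.map (descendTo F ℰp j K (Nat.le_of_succ_le hjK)) (fieldMeasure (F.P K) 0 ↥(Matrix.specialUnitaryGroup (Fin 2) ℂ))).bind ⇑σ =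
          fieldMeasure (F.P K) 0 ↥(Matrix.specialUnitaryGroup (Fin 2) ℂ) →
        (∀ᵐ V ∂(Measure.map (descendTo F ℰp j K (Nat.le_of_succ_le hjK)) (fieldMeasure (F.P K) 0 ↥(Matrix.specialUnitaryGroup (Fin 2) ℂ))),
          ∀ᵐ U ∂(σ V), descendTo F ℰp j K (Nat.le_of_succ_le hjK) U = V) →
      ∃ m : GaugeField (F.P j) 0 ↥(Matrix.specialUnitaryGroup (Fin 2) ℂ) → ℝ,
        ContinuousOn m {V | PlaqSmall (θBal F.L γ b₀ p₀ j) V} ∧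
        (∀ᵐ V ∂(fieldMeasure (F.P j) 0 ↥(Matrix.specialUnitaryGroup (Fin 2) ℂ)), PlaqSmall (θBal F.L γ b₀ p₀ j) V →
          Integrable (fun U => (∏ i ∈ Finset.range (K - j), (if h : j + 1 + i ≤ K then
              (∏ p : Plaq (F.P (j + 1 + i)) 0, max 0 (min 1 ((24 / 25 * θBal F.L γ b₀ p₀ (j + 1 + i) -
                dist1 (GaugeField.plaqHol (descendTo F ℰp (j + 1 + i) K h U) p)) / ((24 / 25 - 1 / 2) * θBal F.L γ b₀ p₀ (j + 1 + i))))) else 1)) *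
            (Real.log (ρ K U) - Real.log (ρ' U)) * ρ' U) (σ V) ∧
          m V = (∫ U, (∏ i ∈ Finset.range (K - j), (if h : j + 1 + i ≤ K then
              (∏ p : Plaq (F.P (j + 1 + i)) 0, max 0 (min 1 ((24 / 25 * θBal F.L γ b₀ p₀ (j + 1 + i) -
                dist1 (GaugeField.plaqHol (descendTo F ℰp (j + 1 + i) K h U) p)) / ((24 / 25 - 1 / 2) * θBal F.L γ b₀ p₀ (j + 1 + i))))) else 1)) *
            (Real.log (ρ K U) - Real.log (ρ' U)) * ρ' U ∂(σ V)) /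
            (∫ U, (∏ i ∈ Finset.range (K - j), (if h : j + 1 + i ≤ K then
              (∏ p : Plaq (F.P (j + 1 + i)) 0, max 0 (min 1 ((24 / 25 * θBal F.L γ b₀ p₀ (j + 1 + i) -
                dist1 (GaugeField.plaqHol (descendTo F ℰp (j + 1 + i) K h U) p)) / ((24 / 25 - 1 / 2) * θBal F.L γ b₀ p₀ (j + 1 + i))))) else 1)) *
            ρ' U ∂(σ V))) := by
  classical
  obtain ⟨j₁, hj₁⟩ := exists_height_fibreMeanVersion_descendTo F γ b₀ p₀ hγ hγ1 hb₀ hp₀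
  obtain ⟨j₂, hj₂⟩ := exists_height_multiWindowWeight F γ b₀ p₀ hγ hγ1 hb₀
  refine ⟨max j₁ j₂, fun j hj K hjK ρ ρ' hρm hcut hρjpos hpos hr hr' σ hσM hbind hfib => ?_⟩
  obtain ⟨hχc, hχ0, hχsupp, hχpos⟩ := hj₂ j (le_of_max_le_right hj) K hjK
  -- the tower of weighted measures and the `ℝ≥0∞` cut-off family
  set μ : (n : ℕ) → Measure (GaugeField (F.P n) 0 ↥(Matrix.specialUnitaryGroup (Fin 2) ℂ)) :=
    fun n => (fieldMeasure (F.P n) 0 ↥(Matrix.specialUnitaryGroup (Fin 2) ℂ)).withDensity (fun V => ENNReal.ofReal (ρ n V)) with hμ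
  set w : (n : ℕ) → GaugeField (F.P n) 0 ↥(Matrix.specialUnitaryGroup (Fin 2) ℂ) → ℝ≥0∞ := fun n U =>
    ENNReal.ofReal (∏ p : Plaq (F.P n) 0, max 0 (min 1 ((24 / 25 * θBal F.L γ b₀ p₀ n - dist1 (GaugeField.plaqHol U p)) / ((24 / 25 - 1 / 2) * θBal F.L γ b₀ p₀ n))))
    with hw
  have hwm : ∀ n, Measurable (w n) := fun n => ENNReal.measurable_ofReal.comp (measurable_sfCutRamp (1 / 2) (24 / 25) _)
  -- clause ⑦ iterated
  have hiter := towerCut_iterate F μ w hwm j K (Nat.le_of_succ_le hjK) (fun n hjn hnK => hcut n hjn hnK)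
  -- the consistency measure and its two letters
  set mY : Measure (GaugeField (F.P K) 0 ↥(Matrix.specialUnitaryGroup (Fin 2) ℂ)) := (μ K).withDensity (fun U =>
    ∏ i ∈ Finset.range (K - j), (if h : j + 1 + i ≤ K then w (j + 1 + i) (descendTo F ℰp (j + 1 + i) K h U) else 1)) with hmY
  have hmYac : mY ≪ fieldMeasure (F.P K) 0 ↥(Matrix.specialUnitaryGroup (Fin 2) ℂ) :=
    (withDensity_absolutelyContinuous _ _).trans (withDensity_absolutelyContinuous _ _)
  have hcons : mY.map (descendTo F ℰp j K (Nat.le_of_succ_le hjK)) =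
      (fieldMeasure (F.P j) 0 ↥(Matrix.specialUnitaryGroup (Fin 2) ℂ)).withDensity (fun V => ENNReal.ofReal (ρ j V)) := hiter.symm
  -- the version
  exact hj₁ j (le_of_max_le_left hj) K hjK (ρ K) ρ' (ρ j) hpos hr hr' (hρm j) hρjpos mY hmYac hcons _ hχc hχ0 hχsupp hχpos σ hσM hbind hfib

/-- ★★★ **SHARPENED EDITION of `exists_height_fibreMeanVersionMW_of_towerCut`** (appended 2026-08-31 for the v18 junction «TaylorCutH», LEAD w3 g25 №1): the SAME
conclusion under `Measurable (ρ j)` ALONE in place of `∀ n, Measurable (ρ n)` — the proof of the original uses measurability of the BOTTOM density only (the tower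
`n ↦ dU_n·ρ_n` enters through `withDensity`, which needs no measurability, and the cut weights are measurable by `measurable_sfCutRamp`). A consumer holding the frame's
block ⑧ on `[j, K]` thus needs the `∃ κ`-membership un-scaling (R-n4) at the level `j` only and NO dummy tower off `[j, K]`.
[cite: Balaban1985Averaging, (10)-(13) p.19; Balaban1987RG1, (0.11) p.253 and (0.13) p.254; Balaban1985UV3, (7) p.257] -/
theorem exists_height_fibreMeanVersionMW_of_towerCut'
    (F : T3Family) (γ b₀ p₀ : ℝ) (hγ : 0 < γ) (hγ1 : γ ≤ 1) (hb₀ : 0 < b₀) (hp₀ : 0 < p₀) :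
    ∃ jA : ℕ, ∀ (j : ℕ), jA ≤ j → ∀ (K : ℕ) (hjK : j + 1 ≤ K),
      ∀ (ρ : (n : ℕ) → GaugeField (F.P n) 0 ↥(Matrix.specialUnitaryGroup (Fin 2) ℂ) → ℝ)
        (ρ' : GaugeField (F.P K) 0 ↥(Matrix.specialUnitaryGroup (Fin 2) ℂ) → ℝ),
        Measurable (ρ j) →
        -- clause ⑦ (one-step SF-projection of the unprimed tower) on `[j, K)`
        (∀ n, j ≤ n → n < K →
          (fieldMeasure (F.P n) 0 ↥(Matrix.specialUnitaryGroup (Fin 2) ℂ)).withDensity (fun V => ENNReal.ofReal (ρ n V)) =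
            Measure.map (descend F ℰp n)
              (((fieldMeasure (F.P (n + 1)) 0 ↥(Matrix.specialUnitaryGroup (Fin 2) ℂ)).withDensity (fun U => ENNReal.ofReal (ρ (n + 1) U))).withDensity
                (fun U => ENNReal.ofReal (∏ p : Plaq (F.P (n + 1)) 0,
                  max 0 (min 1 ((24 / 25 * θBal F.L γ b₀ p₀ (n + 1) - dist1 (GaugeField.plaqHol U p)) / ((24 / 25 - 1 / 2) * θBal F.L γ b₀ p₀ (n + 1)))))))) →
        -- the bottom density is positive on the coarse window; the top densities are positive and continuous on the top window
        (∀ V, PlaqSmall (θBal F.L γ b₀ p₀ j) V → 0 < ρ j V) →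
        (∀ U, PlaqSmall (θBal F.L γ b₀ p₀ K) U → 0 < ρ K U ∧ 0 < ρ' U) →
        ContinuousOn (ρ K) {U | PlaqSmall (θBal F.L γ b₀ p₀ K) U} → ContinuousOn ρ' {U | PlaqSmall (θBal F.L γ b₀ p₀ K) U} →
      ∀ (σ : Kernel (GaugeField (F.P j) 0 ↥(Matrix.specialUnitaryGroup (Fin 2) ℂ)) (GaugeField (F.P K) 0 ↥(Matrix.specialUnitaryGroup (Fin 2) ℂ))),
        IsMarkovKernel σ →
        (Measure.map (descendTo F ℰp j K (Nat.le_of_succ_le hjK)) (fieldMeasure (F.P K) 0 ↥(Matrix.specialUnitaryGroup (Fin 2) ℂ))).bind ⇑σ =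
          fieldMeasure (F.P K) 0 ↥(Matrix.specialUnitaryGroup (Fin 2) ℂ) →
        (∀ᵐ V ∂(Measure.map (descendTo F ℰp j K (Nat.le_of_succ_le hjK)) (fieldMeasure (F.P K) 0 ↥(Matrix.specialUnitaryGroup (Fin 2) ℂ))),
          ∀ᵐ U ∂(σ V), descendTo F ℰp j K (Nat.le_of_succ_le hjK) U = V) →
      ∃ m : GaugeField (F.P j) 0 ↥(Matrix.specialUnitaryGroup (Fin 2) ℂ) → ℝ,
        ContinuousOn m {V | PlaqSmall (θBal F.L γ b₀ p₀ j) V} ∧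
        (∀ᵐ V ∂(fieldMeasure (F.P j) 0 ↥(Matrix.specialUnitaryGroup (Fin 2) ℂ)), PlaqSmall (θBal F.L γ b₀ p₀ j) V →
          Integrable (fun U => (∏ i ∈ Finset.range (K - j), (if h : j + 1 + i ≤ K then
              (∏ p : Plaq (F.P (j + 1 + i)) 0, max 0 (min 1 ((24 / 25 * θBal F.L γ b₀ p₀ (j + 1 + i) -
                dist1 (GaugeField.plaqHol (descendTo F ℰp (j + 1 + i) K h U) p)) / ((24 / 25 - 1 / 2) * θBal F.L γ b₀ p₀ (j + 1 + i))))) else 1)) *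
            (Real.log (ρ K U) - Real.log (ρ' U)) * ρ' U) (σ V) ∧
          m V = (∫ U, (∏ i ∈ Finset.range (K - j), (if h : j + 1 + i ≤ K then
              (∏ p : Plaq (F.P (j + 1 + i)) 0, max 0 (min 1 ((24 / 25 * θBal F.L γ b₀ p₀ (j + 1 + i) -
                dist1 (GaugeField.plaqHol (descendTo F ℰp (j + 1 + i) K h U) p)) / ((24 / 25 - 1 / 2) * θBal F.L γ b₀ p₀ (j + 1 + i))))) else 1)) *
            (Real.log (ρ K U) - Real.log (ρ' U)) * ρ' U ∂(σ V)) /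
            (∫ U, (∏ i ∈ Finset.range (K - j), (if h : j + 1 + i ≤ K then
              (∏ p : Plaq (F.P (j + 1 + i)) 0, max 0 (min 1 ((24 / 25 * θBal F.L γ b₀ p₀ (j + 1 + i) -
                dist1 (GaugeField.plaqHol (descendTo F ℰp (j + 1 + i) K h U) p)) / ((24 / 25 - 1 / 2) * θBal F.L γ b₀ p₀ (j + 1 + i))))) else 1)) *
            ρ' U ∂(σ V))) := by
  classical
  obtain ⟨j₁, hj₁⟩ := exists_height_fibreMeanVersion_descendTo F γ b₀ p₀ hγ hγ1 hb₀ hp₀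
  obtain ⟨j₂, hj₂⟩ := exists_height_multiWindowWeight F γ b₀ p₀ hγ hγ1 hb₀
  refine ⟨max j₁ j₂, fun j hj K hjK ρ ρ' hρj hcut hρjpos hpos hr hr' σ hσM hbind hfib => ?_⟩
  obtain ⟨hχc, hχ0, hχsupp, hχpos⟩ := hj₂ j (le_of_max_le_right hj) K hjK
  -- the tower of weighted measures and the `ℝ≥0∞` cut-off family
  set μ : (n : ℕ) → Measure (GaugeField (F.P n) 0 ↥(Matrix.specialUnitaryGroup (Fin 2) ℂ)) :=
    fun n => (fieldMeasure (F.P n) 0 ↥(Matrix.specialUnitaryGroup (Fin 2) ℂ)).withDensity (fun V => ENNReal.ofReal (ρ n V)) with hμ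
  set w : (n : ℕ) → GaugeField (F.P n) 0 ↥(Matrix.specialUnitaryGroup (Fin 2) ℂ) → ℝ≥0∞ := fun n U =>
    ENNReal.ofReal (∏ p : Plaq (F.P n) 0, max 0 (min 1 ((24 / 25 * θBal F.L γ b₀ p₀ n - dist1 (GaugeField.plaqHol U p)) / ((24 / 25 - 1 / 2) * θBal F.L γ b₀ p₀ n))))
    with hw
  have hwm : ∀ n, Measurable (w n) := fun n => ENNReal.measurable_ofReal.comp (measurable_sfCutRamp (1 / 2) (24 / 25) _)
  -- clause ⑦ iterated
  have hiter := towerCut_iterate F μ w hwm j K (Nat.le_of_succ_le hjK) (fun n hjn hnK => hcut n hjn hnK)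
  -- the consistency measure and its two letters
  set mY : Measure (GaugeField (F.P K) 0 ↥(Matrix.specialUnitaryGroup (Fin 2) ℂ)) := (μ K).withDensity (fun U =>
    ∏ i ∈ Finset.range (K - j), (if h : j + 1 + i ≤ K then w (j + 1 + i) (descendTo F ℰp (j + 1 + i) K h U) else 1)) with hmY
  have hmYac : mY ≪ fieldMeasure (F.P K) 0 ↥(Matrix.specialUnitaryGroup (Fin 2) ℂ) :=
    (withDensity_absolutelyContinuous _ _).trans (withDensity_absolutelyContinuous _ _)
  have hcons : mY.map (descendTo F ℰp j K (Nat.le_of_succ_le hjK)) =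
      (fieldMeasure (F.P j) 0 ↥(Matrix.specialUnitaryGroup (Fin 2) ℂ)).withDensity (fun V => ENNReal.ofReal (ρ j V)) := hiter.symm
  -- the version
  exact hj₁ j (le_of_max_le_left hj) K hjK (ρ K) ρ' (ρ j) hpos hr hr' hρj hρjpos mY hmYac hcons _ hχc hχ0 hχsupp hχpos σ hσM hbind hfib

end Summit.QuantumFields.YangMills.Theorems.FluctuationComparisonRegPrIntLOrganTangentFibreMeanVersionMW

end
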